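import Summits.AnomalousDissipation.AnomalousDissipation.Theorems.SolenoidalFractalHomogenisationLagrangianStepVmodFsHighRow
import Summits.AnomalousDissipation.AnomalousDissipation.Theorems.SolenoidalFractalHomogenisationLagrangianStepVmodBridge
import HarnessLib

/-!
# K1L_D (stmt-AnomalousDissipation-27980): (V_mod) flat stage, block (fs) — ROW H AT ANY CARRIER PHASE: slow tests on HIGH classes, windows of
# length `≥ P = M·W.period/ν` starting ANYWHERE, `ν < νh` (item (b) «general phase» of D28-5 for the W7 row; phase-free twin of
# `fs_pairing_le_of_phase_window_high`, p716944)
(helper; `--supports 27980 --as helper`; prover ad-k1loc-p3 g10.)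

The W7 clause and the bridge speak from carrier phase 0.  For a window `[s,t]` with `t − s ≥ P` let `s₁ := (⌊s/P⌋ + 1)·P ∈ (s, s + P]` be the
first grid point after `s` (carrier phase 0 there, `cellField_add_nat_mul_period`).  By the cocycle `U(s,t) = U(s₁,t)U(s,s₁)`; the head factor
`U(s,s₁)` is a contraction that PRESERVES CLASS PAIRS (`PropagatorSymm.fcoeff_apply_eq_zero_of_classes`), so `w := U(s,s₁)v` is again supported
on the class pair of the high slow label `ℓ`, hence has no Bloch label of norm `< L` (`not_classPair_of_lowLabel`), and T-H on general data
(`VmodGen.norm_apply_le_of_highLabelDecay_general`, p716561) from `s₁` gives `‖U(s,t)v‖ ≤ √CK·e^{−cK·ν·(t−s₁)}·‖v‖ ≤ √CK·e^{cK·M·W.period}·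
e^{−cK·ν·(t−s)}·‖v‖` (`norm_fc_le_of_highClass_anyPhase`).  The (fs) assembly of `…VmodFsHighRow` then yields, WITHOUT any phase hypothesis,

  `|⟪U s t x − T s t x, ζ⟫| ≤ 2·(√CK·e^{cK·M·W.period}·e^{−cK·ν·(t−s)} / √(1 − e^{−8π²·loT·L²·(t−s)})) · √(lossFwd (T s t) x) · √(lossAdj (T s t) ζ)`

(`fs_pairing_le_of_long_window_high`).  `sorry`-free; NOT a proof of (fs), of the stub, of K1L_D or of AD; rung F-D1.A0.
-/


set_option linter.dupNamespace false

noncomputable section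

namespace Summit.AnomalousDissipation.AnomalousDissipation.Theorems.SolenoidalFractalHomogenisation.LagrangianStep.VmodFlat

open Literature.Analysis Literature.Analysis.FluidPDE Literature.Analysis.FunctionSpaces
open MeasureTheory Set Filter UnitAddTorus
open scoped ENNReal NNReal InnerProductSpace
open Summit.AnomalousDissipation.AnomalousDissipation.Theorems.SolenoidalFractalHomogenisation.LagrangianStep.CellClauseMod
open Summit.AnomalousDissipation.AnomalousDissipation.Theorems.SolenoidalFractalHomogenisation.LagrangianStep.LossCurrency
open Summit.AnomalousDissipation.AnomalousDissipation.Theorems.SolenoidalFractalHomogenisation.RealisedQuasiStaticCellLaw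
  (isSmooth_cell isDivFree_cell memLp_top_stLift_cell)
open Summit.AnomalousDissipation.AnomalousDissipation.Theorems.SolenoidalFractalHomogenisation.LagrangianStep.CellChain
  (norm_latticeVec_ge_of_classPair_ne)

/-! ## §1 T-H per label at any phase -/

set_option maxHeartbeats 1600000 in
/-- **Per-label T-H leak at ANY phase.**  Window `[s,t]` of length `≥ M·W.period/ν`, `ν < νh`, `n·ν ≤ Kb·L`, slow label `ℓ` with `L ≤ ‖ℓ‖`,
`2‖ℓ‖ < n`; ANY `v ∈ V2` supported on the class pair of `ℓ`: `‖𝓕(U s t v)(ℓ)‖ ≤ √CK·e^{cK·M·W.period}·e^{−cK·ν·(t−s)}·‖v‖`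
(split at the first grid point after `s`; see the module docstring). -/
theorem norm_fc_le_of_highClass_anyPhase {k : ℕ} (W : LatticeShear.LatticeWord k) (M : ℝ) (hM : 0 < M) {lo hi Λ β νh Kb CK cK : ℝ}
    (hH : HighLabelDecayW W M hM lo hi Λ β νh Kb CK cK) (hlo : 0 < lo) (hhi : 0 ≤ hi) (hΛ : 1 ≤ Λ) (hCK : 1 ≤ CK) (hcK : 0 ≤ cK)
    {ν : ℝ} (hν : ν ∈ Set.Ioo 0 νh) {n : ℕ} (hn : 1 ≤ n) {𝔸 : Torus.Visc4 (Fin 3)} (hodd : Torus.OddSmall 𝔸 (ν * β))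
    (hwin : ∃ lam ∈ Set.Icc (1:ℝ) Λ, Torus.NearIso 𝔸 (ν * (lo / lam)) (ν * (hi * lam)))
    {Tw : ℝ} {U : ℝ → ℝ → (V2 →L[ℝ] V2)} (hU : Torus.IsPropagator Tw (cellField W M hM ν hν.1 n) ((1 / (n:ℝ) ^ 2) • 𝔸) U)
    {s t : ℝ} (hs : 0 ≤ s) (htT : t ≤ Tw) (hτP : M * W.period / ν ≤ t - s)
    {L : ℝ} (hL : 0 < L) (hKL : (n : ℝ) * ν ≤ Kb * L)
    {ℓ : Fin 3 → ℤ} (hℓL : L ≤ ‖Torus.latticeVec ℓ‖) (hℓn : 2 * ‖Torus.latticeVec ℓ‖ < n)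
    (v : V2)
    (hvs : ∀ k', ¬ ((∀ i, (n:ℤ) ∣ k' i - ℓ i) ∨ (∀ i, (n:ℤ) ∣ k' i + ℓ i)) → fc v k' = 0) :
    ‖fc (U s t v) ℓ‖ ≤ Real.sqrt CK * Real.exp (cK * (M * W.period)) * Real.exp (-(cK * ν * (t - s))) * ‖v‖ := by
  classical
  have hnpos : 0 < n := hn
  have hn0 : (0:ℝ) < n := by exact_mod_cast hnpos
  have hν0 : 0 < ν := hν.1
  have hΛ0 : 0 < Λ := lt_of_lt_of_le one_pos hΛ
  have hn2 : (0:ℝ) < 1 / (n:ℝ) ^ 2 := by positivity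
  have hWp : 0 < W.period := PermissibleCarrier.period_pos W
  set P : ℝ := M * W.period / ν with hPdef
  have hP0 : 0 < P := by rw [hPdef]; exact div_pos (mul_pos hM hWp) hν0
  -- the first grid point after `s`
  set m : ℕ := ⌊s / P⌋₊ with hm
  set s₁ : ℝ := ((m + 1 : ℕ) : ℝ) * (M * W.period / ν) with hs₁
  have hms : (m : ℝ) * P ≤ s := by
    have h := Nat.floor_le (div_nonneg hs hP0.le)
    rw [← hm] at h
    have := mul_le_mul_of_nonneg_right h hP0.le
    rwa [div_mul_cancel₀ _ hP0.ne'] at this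
  have hss₁ : s < s₁ := by
    have h := Nat.lt_floor_add_one (s / P)
    rw [← hm] at h
    have h2 : s < ((m:ℝ) + 1) * P := by
      have := mul_lt_mul_of_pos_right h hP0
      rwa [div_mul_cancel₀ _ hP0.ne'] at this
    rw [hs₁]; push_cast; rw [← hPdef]; exact h2
  have hs₁le : s₁ ≤ s + P := by rw [hs₁]; push_cast; rw [← hPdef]; linarith
  have hs₁t : s₁ ≤ t := by linarith
  have hs₁0 : 0 ≤ s₁ := by linarith
  have hphase₁ : ∀ τ, cellField W M hM ν hν.1 n (s₁ + τ) = cellField W M hM ν hν.1 n τ :=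
    fun τ => by rw [hs₁]; exact VmodGen.cellField_add_nat_mul_period W M hM ν hν.1 n (m + 1) τ
  -- the cell window and class-pair preservation
  obtain ⟨lam, hlam, hA𝔸⟩ := hwin
  have hlam0 : 0 < lam := by linarith [hlam.1]
  have hAΛ : Torus.NearIso 𝔸 (ν * (lo / Λ)) (ν * (hi * Λ)) :=
    hA𝔸.mono (mul_le_mul_of_nonneg_left (div_le_div_of_nonneg_left hlo.le hlam0 hlam.2) hν0.le)
      (mul_le_mul_of_nonneg_left (mul_le_mul_of_nonneg_left hlam.2 hhi) hν0.le)
  have hloA : 0 < ν * (lo / Λ) := mul_pos hν0 (div_pos hlo hΛ0)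
  have hcell : Torus.NearIso ((1 / (n:ℝ) ^ 2) • 𝔸) ((1 / (n:ℝ) ^ 2) * (ν * (lo / Λ))) ((1 / (n:ℝ) ^ 2) * (ν * (hi * Λ))) := hAΛ.smul hn2.le
  have hcell_lo : 0 < (1 / (n:ℝ) ^ 2) * (ν * (lo / Λ)) := mul_pos hn2 hloA
  have hbU : MemLp (Torus.stLift (cellField W M hM ν hν.1 n)) ∞ (volume.restrict (Ioo 0 Tw ×ˢ (univ : Set (EuclideanSpace ℝ (Fin 3))))) :=
    memLp_top_stLift_cell _ n Tw
  have hbUdiv : ∀ᵐ τ ∂(volume.restrict (Ioo (0:ℝ) Tw)), Torus.IsWeaklyDivFree (cellField W M hM ν hν.1 n τ) :=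
    ae_of_all _ fun τ => (isDivFree_cell _ n τ).isWeaklyDivFree_holds (isSmooth_cell _ n τ)
  have hgrid : ∀ (j : Fin 3 → Fin n) (τ : ℝ) (y : UnitAddTorus (Fin 3)),
      cellField W M hM ν hν.1 n τ (y + (fun i => ((((j i : ℕ) : ℝ) / n : ℝ) : UnitAddCircle))) = cellField W M hM ν hν.1 n τ y :=
    fun j τ y => by unfold cellField; exact cell_add_grid _ hnpos j τ y
  set w : V2 := U s s₁ v with hw
  have hwdf : w ∈ Torus.divFreeL2 (Fin 3) := (Torus.mem_divFreeL2_iff _).2 (hU.divFree s s₁ v)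
  have hws : ∀ k', ¬ ((∀ i, (n:ℤ) ∣ k' i - ℓ i) ∨ (∀ i, (n:ℤ) ∣ k' i + ℓ i)) → fc w k' = 0 := by
    intro k' hk'
    -- `v` vanishes on the class pair of `k'`, hence so does `w = U s s₁ v`
    have hyv : ∀ k'', ((∀ i, (n:ℤ) ∣ k'' i - k' i) ∨ (∀ i, (n:ℤ) ∣ k'' i + k' i)) → fc v k'' = 0 := by
      intro k'' hk''
      refine hvs k'' ?_
      intro hcl
      apply hk'
      rcases hk'' with h1 | h1 <;> rcases hcl with h2 | h2
      · left; intro i; have := dvd_sub (h2 i) (h1 i); rwa [show k'' i - ℓ i - (k'' i - k' i) = k' i - ℓ i by ring] at this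
      · right; intro i; have := dvd_sub (h2 i) (h1 i); rwa [show k'' i + ℓ i - (k'' i - k' i) = k' i + ℓ i by ring] at this
      · right; intro i; have := dvd_sub (h1 i) (h2 i); rwa [show k'' i + k' i - (k'' i - ℓ i) = k' i + ℓ i by ring] at this
      · left; intro i; have := dvd_sub (h1 i) (h2 i); rwa [show k'' i + k' i - (k'' i + ℓ i) = k' i - ℓ i by ring] at this
    exact PropagatorSymm.fcoeff_apply_eq_zero_of_classes hU hcell hcell_lo hbU hbUdiv hnpos hgrid k' hs hss₁.le (hs₁t.trans htT) v hyv k'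
      (Or.inl fun i => by rw [sub_self]; exact dvd_zero _)
  have hwfs : ∀ k' : Fin 3 → ℤ, (∃ ℓ' z : Fin 3 → ℤ, ‖Torus.latticeVec ℓ'‖ < L ∧ k' = ℓ' + (n : ℤ) • z) → fc w k' = 0 :=
    fun k' hk' => hws k' (not_classPair_of_lowLabel hℓL hℓn hk')
  -- T-H from the grid point (if the tail window is non-degenerate), contraction on the head
  have hwn : ‖w‖ ≤ ‖v‖ := hU.norm_le s s₁ v
  have hcomp : U s t v = U s₁ t w := by rw [hw, hU.comp s s₁ t hs hss₁.le hs₁t htT v]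
  have hexp : Real.exp (-(cK * ν * (t - s₁))) ≤ Real.exp (cK * (M * W.period)) * Real.exp (-(cK * ν * (t - s))) := by
    rw [← Real.exp_add]
    refine Real.exp_le_exp.2 ?_
    have hνP : ν * P = M * W.period := by rw [hPdef]; field_simp
    have h1 : cK * ν * (s₁ - s) ≤ cK * ν * P := mul_le_mul_of_nonneg_left (by linarith) (mul_nonneg hcK hν0.le)
    nlinarith [h1, hνP]
  have hB := sum_norm_sq_fcoeff_le {ℓ} (U s t v)
  rw [Finset.sum_singleton] at hB
  have h2 : ‖fc (U s t v) ℓ‖ ≤ ‖U s t v‖ := by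
    calc ‖fc (U s t v) ℓ‖ = Real.sqrt (‖fc (U s t v) ℓ‖ ^ 2) := (Real.sqrt_sq (norm_nonneg _)).symm
      _ ≤ Real.sqrt (‖U s t v‖ ^ 2) := Real.sqrt_le_sqrt hB
      _ = ‖U s t v‖ := Real.sqrt_sq (norm_nonneg _)
  refine h2.trans ?_
  rw [hcomp]
  rcases eq_or_lt_of_le (hs₁t.trans htT) with heq | hs₁T
  · -- degenerate tail `s₁ = t = Tw`: `U s₁ t w = w`
    have ht : t = s₁ := le_antisymm (heq ▸ htT) hs₁t
    rw [ht, hU.self_of_divFree s₁ hs₁0 heq.le w ((Torus.mem_divFreeL2_iff w).1 hwdf)]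
    refine hwn.trans ?_
    have hC1 : (1:ℝ) ≤ Real.sqrt CK * Real.exp (cK * (M * W.period)) * Real.exp (-(cK * ν * (s₁ - s))) := by
      have h1 : (1:ℝ) ≤ Real.sqrt CK := by rw [← Real.sqrt_one]; exact Real.sqrt_le_sqrt hCK
      have h3 : (1:ℝ) ≤ Real.exp (cK * (M * W.period)) * Real.exp (-(cK * ν * (s₁ - s))) := by
        rw [← Real.exp_add]
        refine Real.one_le_exp ?_
        have hνP : ν * P = M * W.period := by rw [hPdef]; field_simp
        have h4 : cK * ν * (s₁ - s) ≤ cK * ν * P := mul_le_mul_of_nonneg_left (by linarith) (mul_nonneg hcK hν0.le)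
        nlinarith [h4, hνP]
      calc (1:ℝ) = 1 * 1 := (mul_one 1).symm
        _ ≤ Real.sqrt CK * (Real.exp (cK * (M * W.period)) * Real.exp (-(cK * ν * (s₁ - s)))) :=
            mul_le_mul h1 h3 zero_le_one (Real.sqrt_nonneg _)
        _ = _ := by ring
    calc ‖v‖ = 1 * ‖v‖ := (one_mul _).symm
      _ ≤ _ := mul_le_mul_of_nonneg_right hC1 (norm_nonneg _)
  · have hTH := VmodGen.norm_apply_le_of_highLabelDecay_general W M hM hH hlo hhi hΛ (zero_le_one.trans hCK) hν hn hodd ⟨lam, hlam, hA𝔸⟩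
      hU hs₁0 hs₁t htT hs₁T
      hphase₁ hL hKL w hwdf hwfs
    calc ‖U s₁ t w‖ ≤ Real.sqrt CK * Real.exp (-(cK * ν * (t - s₁))) * ‖w‖ := hTH
      _ ≤ Real.sqrt CK * (Real.exp (cK * (M * W.period)) * Real.exp (-(cK * ν * (t - s)))) * ‖v‖ :=
          mul_le_mul (mul_le_mul_of_nonneg_left hexp (Real.sqrt_nonneg _)) hwn (norm_nonneg _) (by positivity)
      _ = _ := by ring

/-! ## §2 Row H of block (fs) at any phase -/

set_option maxHeartbeats 1600000 in
/-- **(fs), ROW H AT ANY PHASE (high slow classes, window of length `≥ M·W.period/ν` beyond the fast saturation time, `ν < νh`).**  See the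
module docstring; the price of the phase is the factor `exp(cK·M·W.period)`. -/
theorem fs_pairing_le_of_long_window_high {k : ℕ} (W : LatticeShear.LatticeWord k) (M : ℝ) (hM : 0 < M) {c : ℝ} (hc : 0 < c)
    (Φ : ℝ → Torus.Visc4 (Fin 3) → Torus.Visc4 (Fin 3)) {lo hi Λ β ν₀ K : ℝ}
    (hlo : 0 < lo) (hhi : 1 ≤ hi) (hΛ : 1 < Λ) (hK : 0 < K)
    {νh Kb CK cK : ℝ} (hH : HighLabelDecayW W M hM lo hi Λ β νh Kb CK cK) (hCK : 1 ≤ CK) (hcK : 0 ≤ cK)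
    {ν : ℝ} (hν : ν ∈ Set.Ioo 0 ν₀) (hνh : ν < νh) {n : ℕ} (hn : (⌈K / ν⌉₊ : ℝ) ≤ n) {𝔸 : Torus.Visc4 (Fin 3)}
    (hodd : Torus.OddSmall 𝔸 (ν * β)) (hwin : ∃ lam ∈ Set.Icc (1:ℝ) Λ, Torus.NearIso 𝔸 (ν * (lo / lam)) (ν * (hi * lam)))
    (hΦw : ∃ lam ∈ Set.Icc (1:ℝ) Λ, Torus.NearIso (Φ ν ((1 / ν) • 𝔸)) (lo / lam) (hi * lam))
    {Tw : ℝ} {U T : ℝ → ℝ → (V2 →L[ℝ] V2)}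
    (hU : Torus.IsPropagator Tw (cellField W M hM ν hν.1 n) ((1 / (n:ℝ) ^ 2) • 𝔸) U)
    (hT : Torus.IsPropagator Tw (fun _ _ => 0) ((1 / (n:ℝ) ^ 2) • (𝔸 + (c / ν) • Φ ν ((1 / ν) • 𝔸))) T)
    {s t : ℝ} (hs : 0 ≤ s) (hst : s < t) (htT : t ≤ Tw) (hτP : M * W.period / ν ≤ t - s)
    {L : ℝ} (hL : 0 < L) (hKL : (n : ℝ) * ν ≤ Kb * L)
    (x ζ : V2) (hx : IsFast n x) (hζ : IsSlow n ζ) (hζH : ∀ k', ‖Torus.latticeVec k'‖ < L → fc ζ k' = 0)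
    (hsat : 1 ≤ 8 * Real.pi ^ 2 * loT lo Λ c ν n * ((n / 4 : ℕ) : ℝ) ^ 2 * (t - s)) :
    |⟪U s t x - T s t x, ζ⟫_ℝ|
      ≤ 2 * (Real.sqrt CK * Real.exp (cK * (M * W.period)) * Real.exp (-(cK * ν * (t - s)))
            / Real.sqrt (1 - Real.exp (-(8 * Real.pi ^ 2 * loT lo Λ c ν n * L ^ 2 * (t - s)))))
          * Real.sqrt (lossFwd (T s t) x) * Real.sqrt (lossAdj (T s t) ζ) := by
  classical
  have hn1 : (1:ℝ) ≤ n := by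
    have h1 : (1:ℝ) ≤ ⌈K / ν⌉₊ := by
      have : 0 < K / ν := div_pos hK hν.1
      exact_mod_cast Nat.one_le_iff_ne_zero.2 (Nat.pos_iff_ne_zero.1 (Nat.ceil_pos.2 this))
    exact h1.trans hn
  have hnpos : 0 < n := by exact_mod_cast (show (0:ℝ) < n by linarith)
  have hn1' : 1 ≤ n := hnpos
  have hn0 : (0:ℝ) < n := by exact_mod_cast hnpos
  have hν0 : 0 < ν := hν.1
  have hΛ0 : 0 < Λ := by linarith
  have hΛ1 : 1 ≤ Λ := hΛ.le
  have hhi0 : 0 ≤ hi := by linarith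
  have hts : 0 < t - s := sub_pos.2 hst
  have hsT : s < Tw := lt_of_lt_of_le hst htT
  have hνI : ν ∈ Set.Ioo 0 νh := ⟨hν0, hνh⟩
  set N₄ : ℕ := n / 4 with hN₄
  set S : Finset (Fin 3 → ℤ) := ((Torus.freqBall (d := Fin 3) (n / 4)).erase 0).filter (fun ℓ => L ≤ ‖Torus.latticeVec ℓ‖) with hS
  have hSsub : ∀ ℓ ∈ S, ℓ ∈ (Torus.freqBall (d := Fin 3) (n / 4)).erase 0 := fun ℓ hℓ => (Finset.mem_filter.1 hℓ).1
  have hSL : ∀ ℓ ∈ S, L ≤ ‖Torus.latticeVec ℓ‖ := fun ℓ hℓ => (Finset.mem_filter.1 hℓ).2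
  have hLN : 2 * (n / 4) < n := by omega
  obtain ⟨lam, hlam, hA𝔸⟩ := hwin
  obtain ⟨lam', hlam', hΦn⟩ := hΦw
  have hlam0 : 0 < lam := by linarith [hlam.1]
  have hlam'0 : 0 < lam' := by linarith [hlam'.1]
  have hcν : 0 ≤ c / ν := div_nonneg hc.le hν0.le
  have hn2 : (0:ℝ) < 1 / (n:ℝ) ^ 2 := by positivity
  have hAΛ : Torus.NearIso 𝔸 (ν * (lo / Λ)) (ν * (hi * Λ)) :=
    hA𝔸.mono (mul_le_mul_of_nonneg_left (div_le_div_of_nonneg_left hlo.le hlam0 hlam.2) hν0.le)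
      (mul_le_mul_of_nonneg_left (mul_le_mul_of_nonneg_left hlam.2 hhi0) hν0.le)
  have hloA : 0 < ν * (lo / Λ) := mul_pos hν0 (div_pos hlo hΛ0)
  have hcell : Torus.NearIso ((1 / (n:ℝ) ^ 2) • 𝔸) ((1 / (n:ℝ) ^ 2) * (ν * (lo / Λ))) ((1 / (n:ℝ) ^ 2) * (ν * (hi * Λ))) := hAΛ.smul hn2.le
  have hcell_lo : 0 < (1 / (n:ℝ) ^ 2) * (ν * (lo / Λ)) := mul_pos hn2 hloA
  have hcoarse0 : Torus.NearIso ((1 / (n:ℝ) ^ 2) • (𝔸 + (c / ν) • Φ ν ((1 / ν) • 𝔸)))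
      ((1 / (n:ℝ) ^ 2) * (ν * (lo / lam) + (c / ν) * (lo / lam'))) ((1 / (n:ℝ) ^ 2) * (ν * (hi * lam) + (c / ν) * (hi * lam'))) :=
    (hA𝔸.add (hΦn.smul hcν)).smul hn2.le
  have hloT_le : loT lo Λ c ν n ≤ (1 / (n:ℝ) ^ 2) * (ν * (lo / lam) + (c / ν) * (lo / lam')) := by
    unfold loT
    have h1 : lo / Λ ≤ lo / lam := div_le_div_of_nonneg_left hlo.le hlam0 hlam.2
    have h2 : lo / Λ ≤ lo / lam' := div_le_div_of_nonneg_left hlo.le hlam'0 hlam'.2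
    have h3 : (ν + c / ν) * (lo / Λ) ≤ ν * (lo / lam) + (c / ν) * (lo / lam') := by
      have := mul_le_mul_of_nonneg_left h1 hν0.le
      have := mul_le_mul_of_nonneg_left h2 hcν
      nlinarith
    exact mul_le_mul_of_nonneg_left h3 hn2.le
  have hloT : 0 < loT lo Λ c ν n := by
    unfold loT
    have hνc : 0 < ν + c / ν := by positivity
    exact mul_pos hn2 (mul_pos hνc (div_pos hlo hΛ0))
  have hcoarse : Torus.NearIso ((1 / (n:ℝ) ^ 2) • (𝔸 + (c / ν) • Φ ν ((1 / ν) • 𝔸)))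
      (loT lo Λ c ν n) ((1 / (n:ℝ) ^ 2) * (ν * (hi * lam) + (c / ν) * (hi * lam'))) := hcoarse0.mono hloT_le le_rfl
  set LT : ℝ := loT lo Λ c ν n with hLTdef
  have hbU : MemLp (Torus.stLift (cellField W M hM ν hν.1 n)) ∞ (volume.restrict (Ioo 0 Tw ×ˢ (univ : Set (EuclideanSpace ℝ (Fin 3))))) :=
    memLp_top_stLift_cell _ n Tw
  have hbUdiv : ∀ᵐ τ ∂(volume.restrict (Ioo (0:ℝ) Tw)), Torus.IsWeaklyDivFree (cellField W M hM ν hν.1 n τ) :=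
    ae_of_all _ fun τ => (isDivFree_cell _ n τ).isWeaklyDivFree_holds (isSmooth_cell _ n τ)
  have hgrid : ∀ (j : Fin 3 → Fin n) (τ : ℝ) (y : UnitAddTorus (Fin 3)),
      cellField W M hM ν hν.1 n τ (y + (fun i => ((((j i : ℕ) : ℝ) / n : ℝ) : UnitAddCircle))) = cellField W M hM ν hν.1 n τ y :=
    fun j τ y => by unfold cellField; exact cell_add_grid _ hnpos j τ y
  have hUcl : ∀ (c' : Fin 3 → ℤ) (y : V2), (∀ k', ((∀ i, (n:ℤ) ∣ k' i - c' i) ∨ (∀ i, (n:ℤ) ∣ k' i + c' i)) →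
        mFourierCoeff (EuclideanSpace.complexify ∘ ⇑y) k' = 0) →
      ∀ k', ((∀ i, (n:ℤ) ∣ k' i - c' i) ∨ (∀ i, (n:ℤ) ∣ k' i + c' i)) →
        mFourierCoeff (EuclideanSpace.complexify ∘ ⇑(U s t y)) k' = 0 :=
    fun c' y hy k' hk' => PropagatorSymm.fcoeff_apply_eq_zero_of_classes hU hcell hcell_lo hbU hbUdiv hnpos hgrid c' hs hst.le htT y hy k' hk'
  have hTmode : ∀ (y : V2) (k' : Fin 3 → ℤ), mFourierCoeff (EuclideanSpace.complexify ∘ ⇑y) k' = 0 →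
      mFourierCoeff (EuclideanSpace.complexify ∘ ⇑(T s t y)) k' = 0 :=
    fun y k' hk' => fc_propagator_eq_zero hcoarse hloT (fun _ _ => rfl) hT hs hst.le htT y hk'
  have halone : ∀ ℓ ∈ S, ∀ k' ∈ S, ((∀ i, (n:ℤ) ∣ k' i - ℓ i) ∨ (∀ i, (n:ℤ) ∣ k' i + ℓ i)) → k' = ℓ ∨ k' = -ℓ :=
    fun ℓ hℓ k' hk' hpair => FlatWindow.alone_of_lt hLN (Finset.mem_of_mem_erase (hSsub ℓ hℓ)) (Finset.mem_of_mem_erase (hSsub k' hk')) hpair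
  have hnsc : ∀ ℓ ∈ S, ¬ (∀ i, (n:ℤ) ∣ ℓ i + ℓ i) :=
    fun ℓ hℓ => FlatWindow.not_selfConj_of_lt hLN (Finset.mem_of_mem_erase (hSsub ℓ hℓ)) (Finset.ne_of_mem_erase (hSsub ℓ hℓ))
  have hSneg : ∀ k' ∈ S, -k' ∈ S := fun k' hk' => by
    have hk'e := hSsub k' hk'
    refine Finset.mem_filter.2 ⟨Finset.mem_erase.2 ⟨neg_ne_zero.2 (Finset.ne_of_mem_erase hk'e),
      Torus.neg_mem_freqBall.2 (Finset.mem_of_mem_erase hk'e)⟩, ?_⟩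
    rw [Torus.latticeVec_neg, norm_neg]; exact hSL k' hk'
  -- the uniform leak `εH` and the weights
  set εH : ℝ := Real.sqrt CK * Real.exp (cK * (M * W.period)) * Real.exp (-(cK * ν * (t - s))) with hεH
  have hεH0 : 0 ≤ εH := by positivity
  set ε : (Fin 3 → ℤ) → ℝ := fun _ => εH with hεdef
  have hε0 : ∀ ℓ, 0 ≤ ε ℓ := fun _ => hεH0
  set dL : ℝ := 1 - Real.exp (-(8 * Real.pi ^ 2 * LT * L ^ 2 * (t - s))) with hdL
  have hdL0 : 0 < dL := by
    rw [hdL]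
    have : Real.exp (-(8 * Real.pi ^ 2 * LT * L ^ 2 * (t - s))) < 1 := Real.exp_lt_one_iff.2 (by
      have : 0 < 8 * Real.pi ^ 2 * LT * L ^ 2 * (t - s) := by positivity
      linarith)
    linarith
  set η : ℝ := εH / Real.sqrt dL with hηdef
  have hη0 : 0 ≤ η := by positivity
  set d : (Fin 3 → ℤ) → ℝ := fun ℓ => dW lo Λ c ν n (t - s) ℓ with hddef
  have hd0 : ∀ ℓ, 0 ≤ d ℓ := fun ℓ => by
    rw [hddef]; unfold dW
    have : Real.exp (-(8 * Real.pi ^ 2 * loT lo Λ c ν n * Torus.freqNormSq ℓ * (t - s))) ≤ 1 := by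
      apply Real.exp_le_one_iff.2
      have := Torus.freqNormSq_nonneg ℓ
      have : 0 ≤ 8 * Real.pi ^ 2 * loT lo Λ c ν n * Torus.freqNormSq ℓ * (t - s) := by positivity
      linarith
    linarith
  have hdLd : ∀ ℓ ∈ S, dL ≤ d ℓ := by
    intro ℓ hℓ
    rw [hdL, hddef]; unfold dW
    have hL2 : L ^ 2 ≤ Torus.freqNormSq ℓ := by
      rw [← Torus.norm_latticeVec_sq]
      exact pow_le_pow_left₀ hL.le (hSL ℓ hℓ) 2
    have hmono : 8 * Real.pi ^ 2 * LT * L ^ 2 * (t - s) ≤ 8 * Real.pi ^ 2 * loT lo Λ c ν n * Torus.freqNormSq ℓ * (t - s) := by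
      rw [hLTdef]
      have : 0 ≤ 8 * Real.pi ^ 2 * loT lo Λ c ν n * (t - s) := by positivity
      nlinarith
    have := Real.exp_le_exp.2 (neg_le_neg hmono)
    linarith
  have hεd : ∀ ℓ ∈ S, ε ℓ ≤ η * Real.sqrt (d ℓ) := by
    intro ℓ hℓ
    show εH ≤ εH / Real.sqrt dL * Real.sqrt (d ℓ)
    have hsd : Real.sqrt dL ≤ Real.sqrt (d ℓ) := Real.sqrt_le_sqrt (hdLd ℓ hℓ)
    have hsd0 : 0 < Real.sqrt dL := Real.sqrt_pos.2 hdL0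
    calc εH = εH / Real.sqrt dL * Real.sqrt dL := by field_simp
      _ ≤ εH / Real.sqrt dL * Real.sqrt (d ℓ) := mul_le_mul_of_nonneg_left hsd (by positivity)
  have hleak : ∀ ℓ ∈ S, ∀ v : V2, v ∈ Torus.divFreeL2 (Fin 3) →
      (∀ k', ¬ ((∀ i, (n:ℤ) ∣ k' i - ℓ i) ∨ (∀ i, (n:ℤ) ∣ k' i + ℓ i)) → mFourierCoeff (EuclideanSpace.complexify ∘ ⇑v) k' = 0) →
      mFourierCoeff (EuclideanSpace.complexify ∘ ⇑v) ℓ = 0 → mFourierCoeff (EuclideanSpace.complexify ∘ ⇑v) (-ℓ) = 0 →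
      ‖mFourierCoeff (EuclideanSpace.complexify ∘ ⇑(U s t v)) ℓ‖ ≤ ε ℓ * ‖v‖ := by
    intro ℓ hℓ v hv hvs _ _
    have hℓball : ℓ ∈ Torus.freqBall (d := Fin 3) (n / 4) := Finset.mem_of_mem_erase (hSsub ℓ hℓ)
    have hℓn : 2 * ‖Torus.latticeVec ℓ‖ < n := by
      have h1 : ‖Torus.latticeVec ℓ‖ ≤ (N₄ : ℝ) := by
        rw [← Real.sqrt_sq (norm_nonneg (Torus.latticeVec ℓ)), Torus.norm_latticeVec_sq, ← Real.sqrt_sq (Nat.cast_nonneg N₄)]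
        exact Real.sqrt_le_sqrt (Torus.mem_freqBall.1 hℓball)
      have h2 : (2:ℝ) * N₄ < n := by exact_mod_cast hLN
      linarith
    exact norm_fc_le_of_highClass_anyPhase W M hM hH hlo hhi0 hΛ1 hCK hcK hνI hn1' hodd ⟨lam, hlam, hA𝔸⟩ hU hs htT hτP hL hKL
      (hSL ℓ hℓ) hℓn v hvs
  have hxS : ∀ k' ∈ S, mFourierCoeff (EuclideanSpace.complexify ∘ ⇑x) k' = 0 :=
    fun k' hk' => hx k' (Finset.mem_of_mem_erase (hSsub k' hk'))
  have hζS : ∀ k', k' ∉ S → mFourierCoeff (EuclideanSpace.complexify ∘ ⇑ζ) k' = 0 := by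
    intro k' hk'
    by_cases hball : k' ∈ Torus.freqBall (d := Fin 3) (n / 4)
    · by_cases hk0 : k' = 0
      · rw [hk0]; exact hζH 0 (by rw [Torus.latticeVec_zero, norm_zero]; exact hL)
      · have hlt : ‖Torus.latticeVec k'‖ < L := by
          by_contra hge
          exact hk' (Finset.mem_filter.2 ⟨Finset.mem_erase.2 ⟨hk0, hball⟩, (not_lt.1 hge)⟩)
        exact hζH k' hlt
    · exact hζ k' hball
  have key := abs_inner_sub_le_sqrt_of_fast_modewise S (U s t) (T s t) ε hnpos hSneg halone hnsc hε0
    (fun y => hU.apply_eq_apply_starProjection s t y) (fun y => hT.apply_eq_apply_starProjection s t y)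
    hUcl hTmode hleak d η hη0 hd0 hεd x ζ hxS hζS
  have hAζ : ∑ k' ∈ S, d k' * ‖mFourierCoeff (EuclideanSpace.complexify ∘ ⇑ζ) k'‖ ^ 2 ≤ lossAdj (T s t) ζ :=
    sum_weight_le_lossAdj hcoarse hloT hT hs hst.le htT S ζ
  have hFx : (1 / 2) * ‖x‖ ^ 2 ≤ lossFwd (T s t) x := by
    have hsupp : ∀ k', fc x k' ≠ 0 → ((N₄ : ℝ)) ^ 2 ≤ Torus.freqNormSq k' := by
      intro k' hk'
      by_contra hlt
      exact hk' (hx k' (Torus.mem_freqBall.2 (le_of_lt (not_le.1 hlt))))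
    have h := lossFwd_ge_of_supp hcoarse hloT (fun _ _ => rfl) hT hs hst.le htT x (sq_nonneg (N₄ : ℝ)) hsupp
    have he : (1:ℝ) / 2 ≤ 1 - Real.exp (-(8 * Real.pi ^ 2 * LT * (N₄:ℝ) ^ 2 * (t - s))) := half_le_one_sub_exp_neg_of_one_le hsat
    exact (mul_le_mul_of_nonneg_right he (sq_nonneg _)).trans h
  have hxle : ‖x‖ ≤ Real.sqrt 2 * Real.sqrt (lossFwd (T s t) x) := by
    rw [← Real.sqrt_mul (by norm_num)]
    calc ‖x‖ = Real.sqrt (‖x‖ ^ 2) := (Real.sqrt_sq (norm_nonneg _)).symm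
      _ ≤ Real.sqrt (2 * lossFwd (T s t) x) := Real.sqrt_le_sqrt (by linarith)
  refine key.trans ?_
  have hs2 : Real.sqrt 2 * Real.sqrt 2 = 2 := Real.mul_self_sqrt (by norm_num)
  calc Real.sqrt 2 * η * ‖x‖ * Real.sqrt (∑ k' ∈ S, d k' * ‖mFourierCoeff (EuclideanSpace.complexify ∘ ⇑ζ) k'‖ ^ 2)
      ≤ Real.sqrt 2 * η * (Real.sqrt 2 * Real.sqrt (lossFwd (T s t) x)) * Real.sqrt (lossAdj (T s t) ζ) :=
        mul_le_mul (mul_le_mul_of_nonneg_left hxle (by positivity)) (Real.sqrt_le_sqrt hAζ) (Real.sqrt_nonneg _) (by positivity)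
    _ = 2 * η * Real.sqrt (lossFwd (T s t) x) * Real.sqrt (lossAdj (T s t) ζ) := by
        rw [show Real.sqrt 2 * η * (Real.sqrt 2 * Real.sqrt (lossFwd (T s t) x)) = (Real.sqrt 2 * Real.sqrt 2) * η * Real.sqrt (lossFwd (T s t) x) by ring, hs2]

end Summit.AnomalousDissipation.AnomalousDissipation.Theorems.SolenoidalFractalHomogenisation.LagrangianStep.VmodFlat

end
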